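import Literature.NumberTheory.LFunctions.TruncatedWeilFormTailOrder
import HarnessLib

/-!
# RH-FREE — «nothing here bears on the truth of RH»: the pole matrix of the truncated Weil form in closed form (Groskin 2026, arXiv:2607.02828, Lemma 2.1: proof of the claim `lemma_2_1_pole`)

PROOF LAYER (theorems only, 0 defs / 0 named facts) for
`Literature/NumberTheory/LFunctions/TruncatedWeilFormTailOrder.lean` (statement file of cell
`rh-columns/lit`; this file written by seat rh-crit-cc-t6, bears_on LADDER-RH W-C/W-P = COLUMN 2 WEIL).
It DISCHARGES the claim `Groskin2026.lemma_2_1_pole` (A. Groskin, *A finite Guinand–Weil dictionary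
and archimedean tail order for the truncated Weil quadratic form*, arXiv:2607.02828v3, proof of
Lemma 2.1, p. 4): with `L = log c`, for all `m, n ∈ I_N`,
`(Q_pole)_{mn} = 32 L sinh²(L/4) (L² − 16π² m n) / ((L² + 16π² m²)(L² + 16π² n²))`,
INCLUDING the diagonal `(Q_pole)_{mm} = ψ₀′(m)` (the divided-difference matrix carries the derivative
on its diagonal).

## Route (elementary; the printed "which is the pole matrix of [CCM, Lemma 4.1] verbatim" gives no proof)

1. `poleSource_eq_closedForm`: for EVERY real `x` (not only integers) the pole source
   `ψ₀(x) = (1/π)∫₀^L 2cosh(y/2) sin(2πx(1 − y/L)) dy` equals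
   `16 x L (cosh(L/2) − cos 2πx)/(L² + 16π² x²)` — by the fundamental theorem of calculus with the
   explicit antiderivative
   `F_x(y) = (4 sinh(y/2) sin(2πx(1 − y/L)) + 8b cosh(y/2) cos(2πx(1 − y/L)))/(1 + 4b²)`, `b = 2πx/L`
   (`hasDerivAt_poleAntideriv`), whose boundary values collapse because `bL = 2πx`.
2. At an integer `m`, `cos 2πm = 1` and `cosh(L/2) − 1 = 2 sinh²(L/4)` give
   `ψ₀(m) = 32 m L sinh²(L/4)/(L² + 16π² m²)` (`poleSource_intCast`), whence the off-diagonal entries by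
   `(ψ₀(m) − ψ₀(n))/(m − n)` and the polynomial identity
   `m(L² + 16π²n²) − n(L² + 16π²m²) = (m − n)(L² − 16π²mn)`.
3. The diagonal: `ψ₀` IS the closed form as a function of `x`, so `ψ₀′(m)` is the derivative of
   `x ↦ 16 x L (cosh(L/2) − cos 2πx)/(L² + 16π² x²)` at `x = m` (quotient rule, `sin 2πm = 0`),
   `= 32 L sinh²(L/4)(L² − 16π²m²)/(L² + 16π²m²)²` (`hasDerivAt_poleClosedForm_intCast`).

Numerical cross-check before typing (Simpson, `L = log 4`, `|m|,|n| ≤ 3`): agreement to `1e−12` on and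
off the diagonal. The source is an unrefereed preprint ([claim: Groskin2026, status: under-review]); a
kernel proof of a finite calculus identity asserts nothing on its authority. Nothing here bears on
Weil positivity or on the truth of RH.
-/

noncomputable section

open Filter Set MeasureTheory Finset Matrix
open scoped Real Topology

namespace Literature.NumberTheory.LFunctions

namespace Groskin2026

/-! ### Trigonometric values at integers -/

/-- `sin(2πm) = 0` for an integer `m`. [folklore] -/
private theorem sin_two_pi_mul_intCast (m : ℤ) : Real.sin (2 * π * m) = 0 := by
  have h := Real.sin_int_mul_pi (2 * m)
  rw [← h]; congr 1; push_cast; ring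

/-- `cos(2πm) = 1` for an integer `m`. [folklore] -/
private theorem cos_two_pi_mul_intCast (m : ℤ) : Real.cos (2 * π * m) = 1 := by
  have h := Real.cos_int_mul_two_pi m
  rw [← h]; congr 1; ring

/-- `cosh(L/2) − 1 = 2 sinh²(L/4)`. [folklore] -/
private theorem cosh_half_sub_one (L : ℝ) : Real.cosh (L / 2) - 1 = 2 * Real.sinh (L / 4) ^ 2 := by
  have h := Real.cosh_two_mul (L / 4)
  have h2 := Real.cosh_sq (L / 4)
  rw [show 2 * (L / 4) = L / 2 by ring] at h
  nlinarith [h, h2]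

/-! ### Step 1: the pole source in closed form, for every real `x` -/

/-- The explicit antiderivative in `y` of the pole-source integrand `2cosh(y/2) sin(2πx(1 − y/L))`:
with `b = 2πx/L`, `d/dy [(4 sinh(y/2) sin(2πx(1−y/L)) + 8b cosh(y/2) cos(2πx(1−y/L)))/(1+4b²)]
= 2cosh(y/2) sin(2πx(1−y/L))`. [cite: Groskin2026, §2.1 eq. (2) and proof of Lemma 2.1 (p. 3–4)] -/
theorem hasDerivAt_poleAntideriv {L : ℝ} (hL : L ≠ 0) (x y : ℝ) :
    HasDerivAt (fun y : ℝ ↦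
        (4 * Real.sinh (y / 2) * Real.sin (2 * π * x * (1 - y / L)) +
          8 * (2 * π * x / L) * Real.cosh (y / 2) * Real.cos (2 * π * x * (1 - y / L))) /
        (1 + 4 * (2 * π * x / L) ^ 2))
      (2 * Real.cosh (y / 2) * Real.sin (2 * π * x * (1 - y / L))) y := by
  set b : ℝ := 2 * π * x / L with hb
  have hden : (1 + 4 * b ^ 2) ≠ 0 := by positivity
  -- inner functions
  have hhalf : HasDerivAt (fun y : ℝ ↦ y / 2) (1 / 2 : ℝ) y := by
    simpa using (hasDerivAt_id y).div_const (2 : ℝ)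
  have hθ : HasDerivAt (fun y : ℝ ↦ 2 * π * x * (1 - y / L)) (2 * π * x * (-(1 / L))) y := by
    have h1 : HasDerivAt (fun y : ℝ ↦ 1 - y / L) (-(1 / L)) y := by
      simpa using ((hasDerivAt_id y).div_const L).const_sub (1 : ℝ)
    exact h1.const_mul (2 * π * x)
  have hsinh : HasDerivAt (fun y : ℝ ↦ Real.sinh (y / 2)) (Real.cosh (y / 2) * (1 / 2)) y :=
    (Real.hasDerivAt_sinh _).comp y hhalf
  have hcosh : HasDerivAt (fun y : ℝ ↦ Real.cosh (y / 2)) (Real.sinh (y / 2) * (1 / 2)) y :=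
    (Real.hasDerivAt_cosh _).comp y hhalf
  have hsin : HasDerivAt (fun y : ℝ ↦ Real.sin (2 * π * x * (1 - y / L)))
      (Real.cos (2 * π * x * (1 - y / L)) * (2 * π * x * (-(1 / L)))) y :=
    (Real.hasDerivAt_sin _).comp y hθ
  have hcos : HasDerivAt (fun y : ℝ ↦ Real.cos (2 * π * x * (1 - y / L)))
      (-Real.sin (2 * π * x * (1 - y / L)) * (2 * π * x * (-(1 / L)))) y :=
    (Real.hasDerivAt_cos _).comp y hθ
  have key : HasDerivAt (fun y : ℝ ↦
      (4 * Real.sinh (y / 2) * Real.sin (2 * π * x * (1 - y / L)) +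
          8 * b * Real.cosh (y / 2) * Real.cos (2 * π * x * (1 - y / L))) / (1 + 4 * b ^ 2)) _ y :=
    (((hsinh.const_mul 4).mul hsin).add ((hcosh.const_mul (8 * b)).mul hcos)).div_const _
  refine key.congr_deriv ?_
  field_simp
  rw [hb]
  field_simp
  ring

/-- **The pole source in closed form** (every real `x`): for `c > 1`, `L = log c`,
`ψ₀(x) = 16 x L (cosh(L/2) − cos 2πx)/(L² + 16π²x²)`. [cite: Groskin2026, §2.1 eq. (2) and proof of Lemma 2.1 (p. 3–4)] -/
theorem poleSource_eq_closedForm {c : ℝ} (hc : 1 < c) (x : ℝ) :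
    poleSource c x =
      16 * x * Real.log c * (Real.cosh (Real.log c / 2) - Real.cos (2 * π * x)) /
        (Real.log c ^ 2 + 16 * π ^ 2 * x ^ 2) := by
  set L : ℝ := Real.log c with hLdef
  have hL : 0 < L := Real.log_pos hc
  have hL0 : L ≠ 0 := hL.ne'
  set b : ℝ := 2 * π * x / L with hb
  have hden : (1 + 4 * b ^ 2) ≠ 0 := by positivity
  have hden2 : (L ^ 2 + 16 * π ^ 2 * x ^ 2) ≠ 0 := by positivity
  -- FTC
  have hFTC := intervalIntegral.integral_eq_sub_of_hasDerivAt (a := 0) (b := L)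
    (fun y _ ↦ hasDerivAt_poleAntideriv hL0 x y)
    (Continuous.intervalIntegrable (by fun_prop) _ _)
  unfold poleSource
  rw [← hLdef, hFTC]
  simp only [div_self hL0, sub_self, mul_zero, Real.sin_zero, Real.cos_zero, zero_div, sub_zero,
    mul_one, Real.sinh_zero, Real.cosh_zero]
  rw [← hb]
  field_simp
  rw [hb]
  field_simp
  ring

/-- The pole source at an integer: `ψ₀(m) = 32 m L sinh²(L/4)/(L² + 16π²m²)`.
[cite: Groskin2026, proof of Lemma 2.1 (p. 4)] -/
theorem poleSource_intCast {c : ℝ} (hc : 1 < c) (m : ℤ) :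
    poleSource c m =
      32 * m * Real.log c * Real.sinh (Real.log c / 4) ^ 2 / (Real.log c ^ 2 + 16 * π ^ 2 * (m : ℝ) ^ 2) := by
  rw [poleSource_eq_closedForm hc, cos_two_pi_mul_intCast, cosh_half_sub_one]
  ring

/-! ### Step 3: the derivative of the closed form at an integer -/

/-- Quotient rule at an integer point: the derivative of `x ↦ 16 x L (cosh(L/2) − cos 2πx)/(L² + 16π²x²)`
at `x = m ∈ ℤ` is `32 L sinh²(L/4) (L² − 16π²m²)/(L² + 16π²m²)²` (`sin 2πm = 0`, `cos 2πm = 1`).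
[cite: Groskin2026, proof of Lemma 2.1 (p. 4)] -/
theorem hasDerivAt_poleClosedForm_intCast {L : ℝ} (hL : 0 < L) (m : ℤ) :
    HasDerivAt (fun x : ℝ ↦ 16 * x * L * (Real.cosh (L / 2) - Real.cos (2 * π * x)) / (L ^ 2 + 16 * π ^ 2 * x ^ 2))
      (32 * L * Real.sinh (L / 4) ^ 2 * (L ^ 2 - 16 * π ^ 2 * (m : ℝ) ^ 2) /
        (L ^ 2 + 16 * π ^ 2 * (m : ℝ) ^ 2) ^ 2) m := by
  have hD : (L ^ 2 + 16 * π ^ 2 * (m : ℝ) ^ 2) ≠ 0 := by positivity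
  -- numerator
  have hcos : HasDerivAt (fun x : ℝ ↦ Real.cos (2 * π * x)) (-Real.sin (2 * π * m) * (2 * π)) m := by
    have h1 : HasDerivAt (fun x : ℝ ↦ 2 * π * x) (2 * π) m := by
      simpa using (hasDerivAt_id (m : ℝ)).const_mul (2 * π)
    exact (Real.hasDerivAt_cos _).comp (m : ℝ) h1
  have hnum : HasDerivAt (fun x : ℝ ↦ 16 * x * L * (Real.cosh (L / 2) - Real.cos (2 * π * x)))
      (16 * 1 * L * (Real.cosh (L / 2) - Real.cos (2 * π * m)) +
        16 * m * L * (-(-Real.sin (2 * π * m) * (2 * π)))) m := by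
    have hlin : HasDerivAt (fun x : ℝ ↦ 16 * x * L) (16 * 1 * L) m := by
      have := ((hasDerivAt_id (m : ℝ)).const_mul 16).mul_const L
      simpa using this
    exact hlin.mul (hcos.const_sub (Real.cosh (L / 2)))
  have hden : HasDerivAt (fun x : ℝ ↦ L ^ 2 + 16 * π ^ 2 * x ^ 2) (16 * π ^ 2 * (2 * (m : ℝ))) m := by
    have h1 : HasDerivAt (fun x : ℝ ↦ x ^ 2) (2 * (m : ℝ)) m := by
      simpa using hasDerivAt_pow 2 (m : ℝ)
    simpa using (h1.const_mul (16 * π ^ 2)).const_add (L ^ 2)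
  have key : HasDerivAt
      (fun x : ℝ ↦ 16 * x * L * (Real.cosh (L / 2) - Real.cos (2 * π * x)) / (L ^ 2 + 16 * π ^ 2 * x ^ 2))
      _ m := hnum.div hden hD
  refine key.congr_deriv ?_
  rw [sin_two_pi_mul_intCast, cos_two_pi_mul_intCast, cosh_half_sub_one]
  field_simp
  ring

/-! ### Assembly -/

/-- **[Gr26] Lemma 2.1 (pole matrix in closed form), PROVED** — discharge of the claim
`lemma_2_1_pole`: with `L = log c`, for all `m, n ∈ I_N` (diagonal included),
`(Q_pole)_{mn} = 32 L sinh²(L/4) (L² − 16π² m n)/((L² + 16π² m²)(L² + 16π² n²))`.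
[cite: Groskin2026, Lemma 2.1, proof (p. 4)] -/
theorem lemma_2_1_pole_holds : lemma_2_1_pole := by
  intro c hc N m n
  have hL : 0 < Real.log c := Real.log_pos hc
  unfold poleMatrix dividedDiffMatrix
  rw [Matrix.of_apply]
  split_ifs with h
  · -- diagonal: ψ₀′(m)
    have hfun : poleSource c = fun x : ℝ ↦
        16 * x * Real.log c * (Real.cosh (Real.log c / 2) - Real.cos (2 * π * x)) /
          (Real.log c ^ 2 + 16 * π ^ 2 * x ^ 2) := funext (poleSource_eq_closedForm hc)
    rw [hfun, (hasDerivAt_poleClosedForm_intCast hL (m : ℤ)).deriv]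
    have hmn : ((n : ℤ) : ℝ) = ((m : ℤ) : ℝ) := by rw [h]
    rw [hmn]
    have hD : (Real.log c ^ 2 + 16 * π ^ 2 * ((m : ℤ) : ℝ) ^ 2) ≠ 0 := by positivity
    field_simp
  · -- off-diagonal: divided difference of the integer values
    rw [poleSource_intCast hc, poleSource_intCast hc]
    have hmn : ((m : ℤ) : ℝ) - ((n : ℤ) : ℝ) ≠ 0 := by
      rw [sub_ne_zero]; exact_mod_cast h
    have hDm : (Real.log c ^ 2 + 16 * π ^ 2 * ((m : ℤ) : ℝ) ^ 2) ≠ 0 := by positivity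
    have hDn : (Real.log c ^ 2 + 16 * π ^ 2 * ((n : ℤ) : ℝ) ^ 2) ≠ 0 := by positivity
    field_simp
    ring

end Groskin2026

end Literature.NumberTheory.LFunctions

end
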